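import Summits.ValiantsHypothesis.ValiantsHypothesis.Theses.RyserTripartition
import Literature.Computability.AlgebraicComplexity.SetMultilinear

/-!
# Birth skeleton (BC3) for crux `RyserTripartition.MultilinearRyserOptimal` (stmt-ValiantsHypothesis-11285)

Route `route-ValiantsHypothesis-RyserTripartition`, crux rank 3 (route decl
`Summit.ValiantsHypothesis.ValiantsHypothesis.Theses.RyserTripartition.MultilinearRyserOptimal`):
for every `ε > 0` and all large `n`, every fan-in-two SYNTACTICALLY MULTILINEAR circuit over `ℂ`
computing `per_n = perPoly (Fin n) ℂ` has at least `2^((1-ε) n)` gates (Ryser's formula and the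
row-subset dynamic programme are such circuits, of size `~ n·2^n`).

## Line `birth` — pay for the rows, then pay for the columns

Every known `2^n·poly(n)` circuit for the permanent is an INCLUSION–EXCLUSION OVER ONE SIDE of the
matrix: Ryser/Glynn multiply one linear form per ROW (`∏_i ∑_{j ∈ T} x_{ij}`, summed over column
sets `T`), the dynamic programme `p_{j+1}(T ∪ {c}) = ∑ p_j(T) · x_{j,c}` adds one ROW at a time; in
both, every gate computes a polynomial that is SET-MULTILINEAR WITH RESPECT TO THE ROWS (degree
exactly one in each row of some row set `S_v`, zero in the others) and the whole price `2^n` is the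
bookkeeping of COLUMN subsets.  A syntactically multilinear circuit need not have this row
discipline (e.g. the transposed, column-Ryser formula multiplies distinct columns and repeats
rows inside a gate), so the crux splits along the two sides of the matrix:

* **Stub A `stub_rowDiscipline`** (OPEN — transfer; implied by the crux).  Row discipline is cheap
  for the permanent: for every `ε > 0` and all large `n`, every fan-in-two syntactically multilinear
  circuit `P` computing `per_n` can be replaced by a fan-in-two syntactically multilinear circuit
  `Q` computing `per_n` ALL OF WHOSE GATE VALUES ARE ROW-SET-MULTILINEAR
  (`∀ g ∈ gateValues Q.gates, ∃ S, IsSetMultilinear Prod.fst S g`, the tree's LST rendering of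
  set-multilinearity, `SetMultilinear.lean`) with `|Q| ≤ 2^(ε n) · |P|`.  Why plausibly true: it
  follows from the crux itself (if `|P| ≥ 2^((1-ε)n)` then the row DP, of size `≤ n²·2^n`, is such a
  `Q` within a factor `2^(2εn)`), and independently it says only that row-impure products — whose
  row-repeated monomials must all cancel before the output — buy at most a subexponential factor.
  Why it might fail: a sub-Ryser syntactically multilinear circuit whose savings come precisely from
  row-impure products (column-side cancellations with no row-disciplined analogue); generic
  set-multilinearisation of a circuit w.r.t. `n` blocks costs a factor `2^n`–`3^n` (one component per
  subset of the row set of each gate), which is the whole budget.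
* **Stub B `stub_rowSetMultilinearRyser`** (OPEN — the heart).  Ryser is optimal among
  ROW-SET-MULTILINEAR syntactically multilinear circuits: with the extra hypothesis that every gate
  value is row-set-multilinear, `|P| ≥ 2^((1-ε) n)` for all large `n`.  This is the crux restricted to
  the standard set-multilinear circuit model (blocks = rows), i.e. the statement that, once the rows
  are disciplined for free, the COLUMN inclusion–exclusion still costs `2^((1-o(1))n)`.  It sits
  strictly between what is known — Nisan's bound `∑_j binom(n,j) = 2^n` for (row-ordered)
  set-multilinear / non-commutative ABPs (doi:10.1145/103418.103462), Nisan–Wigderson's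
  `binom(n,⌊n/2⌋) ≈ 2^n/√n` for homogeneous ΣΠΣ (partial derivatives, doi:10.1007/BF01294256; tree `flatteningRank_perPoly`),
  Jerrum–Snir's exact monotone `n(2^(n-1)-1)` — and the crux; super-polynomial lower bounds for
  unbounded-depth set-multilinear CIRCUITS are open (formulas: `n^Ω(log n)`, Raz; constant depth:
  LST 2021).  Why easier than the crux: the set-multilinear world is closed under the block
  projections `smlProj` (tree), carries the relative-rank / lopsided partial-derivative measures of
  LST and the duality with ABP width and tensor rank (per_n becomes the `n`-block permanent tensor),
  none of which survive row-impure products.  Why it might fail: exactly as the crux — a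
  `(2-δ)^n` set-multilinear circuit for `per_n`; and it is NOT insulated from the route's hostage
  phenomenon: the bridge circuits of `PerLeTripartition` (Laplace over row blocks + row DP tables +
  a homogenised circuit for Pratt's `T_k`) are row-set-multilinear, so B already forces
  `TripartitionHard` for general circuits, like the crux (HostageGlue).

Composition `MultilinearRyserOptimal_of` (sorry-free): given `ε`, run A and B at `ε/2`; for an
admissible `P` and `n ≥ max n_A n_B`, `2^((1-ε/2)n) ≤ |Q| ≤ 2^((ε/2)n)·|P|`, and
`2^((1-ε)n)·2^((ε/2)n) = 2^((1-ε/2)n)` (`Real.rpow_add`), so `2^((1-ε)n) ≤ |P|`.  Both stubs are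
load-bearing, DEF-FREE beyond the tree (`ArithCircuit`, `IsSyntacticallyMultilinear`, `perPoly`,
`IsSetMultilinear`, `ArithCircuit.gateValues`), and each can land as
`Theorems/RyserTripartitionMultilinearRyserOptimal<Stub>.lean` with
`--supports stmt-ValiantsHypothesis-11285`.  The crux is EQUIVALENT to A ∧ B given the row DP
(`crux → B` is the remark `stub_rowSetMultilinearRyser_of_crux` below; `crux → A` needs the explicit
row-set-multilinear DP/Glynn circuit of size `2^n·poly(n)`, cf. refuter evidence `SmGlynn.lean` on the
item), so neither half is decoration.

Disproof used: none exists for this crux (`ledger crux ls stmt-ValiantsHypothesis-11285`: no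
workfiles before this one); the refuter crux-attacks on the item (rattack-11085/11101/11207/11244/
11285/11116/11266, 2026-08-15) all read SURVIVES / open both ways, with `∃ n₀` load-bearing
(`n ≤ 2` fails pointwise) and `0 < ε` load-bearing (`ε = -1` refuted by Glynn) — both stubs keep the
same `∀ ε > 0, ∃ n₀` shape.

Shape (skeleton audit by-name rule, as `Cruxes/RyserOptimalDepth3/Lines/birth.lean`): §1 the stub
statements as named Props `Sig.stub_*` · §2 the registered sorried stubs `stub_*` with the statements
spelled out (`sorry` lives only there) · §3 `MultilinearRyserOptimal_of` (hypotheses = the `Sig`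
Props, conclusion = the route decl BY NAME), the hypothesis-free `MultilinearRyserOptimal_proof`
(the compiler checks that the `Sig` copies and the stub statements agree), and the remark
`stub_rowSetMultilinearRyser_of_crux` (B is a weakening of the crux).
-/

set_option linter.dupNamespace false

namespace Summit.ValiantsHypothesis.ValiantsHypothesis.Cruxes.MultilinearRyserOptimal.Birth

open MvPolynomial
open Literature.Computability.AlgebraicComplexity
open scoped BigOperators

/-! ## §1 The stub statements as named propositions -/

namespace Sig

/-- **Stub A** — ROW DISCIPLINE IS CHEAP FOR THE PERMANENT (open; transfer): a fan-in-two
syntactically multilinear circuit for `per_n` can be replaced by one all of whose gate values are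
set-multilinear with respect to the rows (`Prod.fst`), at a cost factor `2^(ε n)`. -/
def stub_rowDiscipline : Prop :=
  ∀ ε : ℝ, 0 < ε → ∃ n₀ : ℕ, ∀ n ≥ n₀,
    ∀ P : ArithCircuit ℂ (Fin n × Fin n),
      P.IsFanInTwo ∧ IsSyntacticallyMultilinear P ∧ P.Computes (perPoly (Fin n) ℂ) →
        ∃ Q : ArithCircuit ℂ (Fin n × Fin n),
          Q.IsFanInTwo ∧ IsSyntacticallyMultilinear Q ∧
            (∀ g ∈ ArithCircuit.gateValues Q.gates,
                ∃ S : Finset (Fin n), IsSetMultilinear (Prod.fst : Fin n × Fin n → Fin n) S g) ∧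
              Q.Computes (perPoly (Fin n) ℂ) ∧
                (Q.size : ℝ) ≤ (2 : ℝ) ^ (ε * (n : ℝ)) * (P.size : ℝ)

/-- **Stub B** — RYSER IS OPTIMAL FOR ROW-SET-MULTILINEAR CIRCUITS (open; the heart): a fan-in-two
syntactically multilinear circuit for `per_n` all of whose gate values are row-set-multilinear has
at least `2^((1-ε) n)` gates, for all large `n`. -/
def stub_rowSetMultilinearRyser : Prop :=
  ∀ ε : ℝ, 0 < ε → ∃ n₀ : ℕ, ∀ n ≥ n₀,
    ∀ P : ArithCircuit ℂ (Fin n × Fin n),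
      P.IsFanInTwo ∧ IsSyntacticallyMultilinear P ∧
          (∀ g ∈ ArithCircuit.gateValues P.gates,
              ∃ S : Finset (Fin n), IsSetMultilinear (Prod.fst : Fin n × Fin n → Fin n) S g) ∧
            P.Computes (perPoly (Fin n) ℂ) →
        (2 : ℝ) ^ ((1 - ε) * (n : ℝ)) ≤ (P.size : ℝ)

end Sig

/-! ## §2 The registered stubs (statements spelled out; `sorry` lives only here) -/

/-- **Stub A (registered)** — ROW DISCIPLINE IS CHEAP FOR THE PERMANENT: for every `ε > 0` there
is `n₀` such that for all `n ≥ n₀`, every fan-in-two syntactically multilinear circuit `P` over `ℂ`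
computing `perPoly (Fin n) ℂ` admits a fan-in-two syntactically multilinear circuit `Q` computing
`perPoly (Fin n) ℂ`, every gate value of which is set-multilinear w.r.t. the rows, with
`|Q| ≤ 2^(ε n) · |P|`.  Implied by the crux (row DP of size `≤ n²·2^n`); in general
set-multilinearisation w.r.t. `n` blocks costs `2^n`–`3^n`, so the content is that row-impure
products save the permanent at most a subexponential factor.
[cite: RazYehudayoff2008, §2] [cite: LimayeSrinivasanTavenas2025, §2, Lemma 12] -/
theorem stub_rowDiscipline :
    ∀ ε : ℝ, 0 < ε → ∃ n₀ : ℕ, ∀ n ≥ n₀,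
      ∀ P : ArithCircuit ℂ (Fin n × Fin n),
        P.IsFanInTwo ∧ IsSyntacticallyMultilinear P ∧ P.Computes (perPoly (Fin n) ℂ) →
          ∃ Q : ArithCircuit ℂ (Fin n × Fin n),
            Q.IsFanInTwo ∧ IsSyntacticallyMultilinear Q ∧
              (∀ g ∈ ArithCircuit.gateValues Q.gates,
                  ∃ S : Finset (Fin n), IsSetMultilinear (Prod.fst : Fin n × Fin n → Fin n) S g) ∧
                Q.Computes (perPoly (Fin n) ℂ) ∧
                  (Q.size : ℝ) ≤ (2 : ℝ) ^ (ε * (n : ℝ)) * (P.size : ℝ) := by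
  sorry

/-- **Stub B (registered)** — RYSER IS OPTIMAL FOR ROW-SET-MULTILINEAR CIRCUITS (the heart, open):
for every `ε > 0` there is `n₀` such that for all `n ≥ n₀`, every fan-in-two syntactically
multilinear circuit over `ℂ` computing `perPoly (Fin n) ℂ` whose gate values are all
set-multilinear w.r.t. the rows has at least `2^((1-ε) n)` gates.  Known below it: Nisan's `2^n`
for row-ordered set-multilinear ABPs, Nisan–Wigderson-type `binom(n,⌊n/2⌋)` for homogeneous ΣΠΣ
(tree `flatteningRank_perPoly`), Jerrum–Snir's monotone `n(2^(n-1)-1)`; open for set-multilinear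
circuits of unbounded depth.
[cite: Nisan1991, Thm. 1] [cite: NisanWigderson1996, §3] [cite: RazYehudayoff2008, §2] -/
theorem stub_rowSetMultilinearRyser :
    ∀ ε : ℝ, 0 < ε → ∃ n₀ : ℕ, ∀ n ≥ n₀,
      ∀ P : ArithCircuit ℂ (Fin n × Fin n),
        P.IsFanInTwo ∧ IsSyntacticallyMultilinear P ∧
            (∀ g ∈ ArithCircuit.gateValues P.gates,
                ∃ S : Finset (Fin n), IsSetMultilinear (Prod.fst : Fin n × Fin n → Fin n) S g) ∧
              P.Computes (perPoly (Fin n) ℂ) →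
          (2 : ℝ) ^ ((1 - ε) * (n : ℝ)) ≤ (P.size : ℝ) := by
  sorry

/-! ## §3 Composition (sorry-free) -/

/-- **The line closes the crux**: row discipline (A) at `ε/2` followed by the row-set-multilinear
lower bound (B) at `ε/2` gives `RyserTripartition.MultilinearRyserOptimal` BY NAME:
`2^((1-ε)n) · 2^((ε/2)n) = 2^((1-ε/2)n) ≤ |Q| ≤ 2^((ε/2)n) · |P|`. -/
theorem MultilinearRyserOptimal_of :
    Sig.stub_rowDiscipline → Sig.stub_rowSetMultilinearRyser →
      Summit.ValiantsHypothesis.ValiantsHypothesis.Theses.RyserTripartition.MultilinearRyserOptimal := by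
  intro hA hB ε hε
  obtain ⟨n₁, hA⟩ := hA (ε / 2) (by positivity)
  obtain ⟨n₂, hB⟩ := hB (ε / 2) (by positivity)
  refine ⟨max n₁ n₂, fun n hn P hP => ?_⟩
  obtain ⟨Q, hQ2, hQsm, hQrows, hQper, hQsize⟩ := hA n (le_of_max_le_left hn) P hP
  -- the lower bound in the row-set-multilinear model, applied to `Q`
  have hlow : (2 : ℝ) ^ ((1 - ε / 2) * (n : ℝ)) ≤ (Q.size : ℝ) :=
    hB n (le_of_max_le_right hn) Q ⟨hQ2, hQsm, hQrows, hQper⟩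
  have hpos : (0 : ℝ) < (2 : ℝ) ^ (ε / 2 * (n : ℝ)) := Real.rpow_pos_of_pos (by norm_num) _
  have key : (2 : ℝ) ^ ((1 - ε) * (n : ℝ)) * (2 : ℝ) ^ (ε / 2 * (n : ℝ)) =
      (2 : ℝ) ^ ((1 - ε / 2) * (n : ℝ)) := by
    rw [← Real.rpow_add (by norm_num : (0 : ℝ) < 2)]
    congr 1
    ring
  have hchain : (2 : ℝ) ^ ((1 - ε) * (n : ℝ)) * (2 : ℝ) ^ (ε / 2 * (n : ℝ)) ≤
      (P.size : ℝ) * (2 : ℝ) ^ (ε / 2 * (n : ℝ)) := by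
    rw [key, mul_comm (P.size : ℝ)]
    exact hlow.trans hQsize
  exact le_of_mul_le_mul_right hchain hpos

/-- THE SKELETON: the crux, modulo exactly the two registered stubs (the compiler checks that the
`Sig` copies and the stub statements agree). -/
theorem MultilinearRyserOptimal_proof :
    Summit.ValiantsHypothesis.ValiantsHypothesis.Theses.RyserTripartition.MultilinearRyserOptimal :=
  MultilinearRyserOptimal_of stub_rowDiscipline stub_rowSetMultilinearRyser

/-- Remark (sorry-free): Stub B is a WEAKENING of the crux — the crux restricted to the
row-set-multilinear sub-model (so `crux ↔ A ∧ B` once the row DP witnesses `crux → A`). -/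
theorem stub_rowSetMultilinearRyser_of_crux :
    Summit.ValiantsHypothesis.ValiantsHypothesis.Theses.RyserTripartition.MultilinearRyserOptimal →
      Sig.stub_rowSetMultilinearRyser := by
  intro h ε hε
  obtain ⟨n₀, h⟩ := h ε hε
  exact ⟨n₀, fun n hn P hP => h n hn P ⟨hP.1, hP.2.1, hP.2.2.2⟩⟩

end Summit.ValiantsHypothesis.ValiantsHypothesis.Cruxes.MultilinearRyserOptimal.Birth
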